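import Summits.AtomisticToContinuum.Crystallization.Theorems.FreeSplittingCertificatesStrictSplittingRuleLineTrussEulerMaclaurin

/-!
# `StrictSplittingRule` (stmt-AtomisticToContinuum-12560): the trapezoid step and the second-order expansion of the line-truss tension

Route `FreeSplittingCertificates`, crux r3 `StrictSplittingRule`, line `registered` (unit b2b-freesplit-B, gen 14); sequel of
`…LineTrussEulerMaclaurin.lean`.  With `Φ(t) = ½W(‖v + te‖²)`, `F = Φ′` the load of the line truss and `F′`, `F″` its derivatives,
the TRAPEZOID STEP `|F(k+1) − (Φ(k+1) − Φ(k)) − ½(F(k+1) − F(k))| ≤ (1/12)·sup_{[k,k+1]}|F″|` (integration by parts against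
`s − k − ½`, mean value bound, `∫(s−k−½)² = 1/12`) summed over `k ≥ 0` gives the second-order Euler–Maclaurin expansion of the
outgoing tail

* `h1_tail_asymp2` — for `v, e ≠ 0`, `⟪v,e⟫ ≥ 0`:
  `|Σ_{m≥1} W′(‖v+me‖²)⟪v+me,e⟫ + ½V_LJ(‖v‖) + ½W′(‖v‖²)⟪v,e⟫| ≤ (K₂/12)(‖e‖³‖v‖⁻⁹ + (5π/32)‖e‖²‖v‖⁻⁸)`, `K₂ = 52 + 133‖v‖⁻⁶`,

i.e. `τ = r⁻⁶/12 − r⁻¹²/24 − ½W′(r²)⟪v,e⟫ + O(‖e‖²r⁻⁸)` with the first-order anisotropy `−½W′(r²)⟪v,e⟫` (`|·| ≤ ‖e‖r⁻⁷/4`)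
explicit — the true-β inflation bound of the far lemma (HOME CERT.md §21, FAR-LEMMA-SPEC §11 (d)(1)); the corollaries for the
tension `τ c s d` of the landed design (both orientations) and the numerical inflation factors are in the next file.
Structural bookkeeping ([folklore]: Euler–Maclaurin to second order); VALUE = a kernel-checked brick of the far lemma — NOT a proof
of H12⋆, NOT summit progress.
-/

noncomputable section

namespace Summit.AtomisticToContinuum.Crystallization.Theorems.StrictSplittingRuleBirth

open scoped BigOperators Topology
open Filter Set
open Literature.MathematicalPhysics.StatisticalMechanics
open Summit.AtomisticToContinuum.Crystallization.Theorems.PalmUnimodularRigidity.LayeredLawsSelectHcp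

/-! ## §3 The trapezoid (second-order Euler–Maclaurin) step and the assembled expansion -/

section Line2

variable {v e : EuclideanSpace ℝ (Fin 3)}

/-- `∫_{k}^{k+1} (s − (k+½))² ds = 1/12`. [folklore] -/
theorem h1_integral_sq_centered (k : ℝ) : ∫ s in k..(k + 1), (s - (k + 1 / 2)) ^ 2 = 1 / 12 := by
  rw [intervalIntegral.integral_comp_sub_right (fun x : ℝ => x ^ 2) (k + 1 / 2), integral_pow]
  norm_num

/-- `∫_{k}^{k+1} (s − (k+½)) ds = 0`. [folklore] -/
theorem h1_integral_centered (k : ℝ) : ∫ s in k..(k + 1), (s - (k + 1 / 2)) = 0 := by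
  rw [intervalIntegral.integral_comp_sub_right (fun x : ℝ => x) (k + 1 / 2), integral_id]
  norm_num

/-- **The trapezoid step.**  On an outgoing line (`v ≠ 0`, `⟪v,e⟫ ≥ 0`), for every `k ≥ 0`, with `Φ(t) = ½W(‖v+te‖²)`,
`F = Φ′` the load, `F′` and `F″` its derivatives (`h1_line_hasDerivAt_load`, `h1_line_hasDerivAt_load2`):
`|F(k+1) − (Φ(k+1) − Φ(k)) − ½(F(k+1) − F(k))| ≤ (1/12)·(52 + 133‖v‖⁻⁶)‖e‖³‖v + ke‖⁻⁹`
(integration by parts `∫_k^{k+1}(s−k−½)F′ = ½F(k+1) + ½F(k) − ∫_k^{k+1}F`, then `= ∫(s−k−½)(F′(s) − F′(k+½))` with the mean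
value bound `|F′(s) − F′(k+½)| ≤ sup|F″|·|s−k−½|` and `∫(s−k−½)² = 1/12`). [folklore] -/
theorem h1_tail_step2 (hv : 0 < ‖v‖) (hve : 0 ≤ inner ℝ v e) {k : ℝ} (hk : 0 ≤ k) :
    |ljSqDeriv (‖v + (k + 1) • e‖ ^ 2) * inner ℝ (v + (k + 1) • e) e -
          (1 / 2 * (1 / 12 * ((‖v + (k + 1) • e‖ ^ 2)⁻¹) ^ 6 - 1 / 6 * ((‖v + (k + 1) • e‖ ^ 2)⁻¹) ^ 3) -
            1 / 2 * (1 / 12 * ((‖v + k • e‖ ^ 2)⁻¹) ^ 6 - 1 / 6 * ((‖v + k • e‖ ^ 2)⁻¹) ^ 3)) -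
        1 / 2 * (ljSqDeriv (‖v + (k + 1) • e‖ ^ 2) * inner ℝ (v + (k + 1) • e) e -
          ljSqDeriv (‖v + k • e‖ ^ 2) * inner ℝ (v + k • e) e)| ≤
      1 / 12 * ((52 + 133 * (‖v‖⁻¹) ^ 6) * ‖e‖ ^ 3 * (‖v + k • e‖⁻¹) ^ 9) := by
  -- names
  set Φ : ℝ → ℝ := fun t => 1 / 2 * (1 / 12 * ((‖v + t • e‖ ^ 2)⁻¹) ^ 6 - 1 / 6 * ((‖v + t • e‖ ^ 2)⁻¹) ^ 3) with hΦ
  set F : ℝ → ℝ := fun t => ljSqDeriv (‖v + t • e‖ ^ 2) * inner ℝ (v + t • e) e with hF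
  set F₁ : ℝ → ℝ := fun t => (7 / 2 * ((‖v + t • e‖ ^ 2)⁻¹) ^ 8 - 2 * ((‖v + t • e‖ ^ 2)⁻¹) ^ 5) *
      (2 * inner ℝ (v + t • e) e ^ 2) + ljSqDeriv (‖v + t • e‖ ^ 2) * ‖e‖ ^ 2 with hF₁
  set F₂ : ℝ → ℝ := fun t => (10 * ((‖v + t • e‖ ^ 2)⁻¹) ^ 6 - 28 * ((‖v + t • e‖ ^ 2)⁻¹) ^ 9) *
      (4 * inner ℝ (v + t • e) e ^ 3) + (7 / 2 * ((‖v + t • e‖ ^ 2)⁻¹) ^ 8 - 2 * ((‖v + t • e‖ ^ 2)⁻¹) ^ 5) *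
        (6 * inner ℝ (v + t • e) e * ‖e‖ ^ 2) with hF₂
  set M : ℝ := (52 + 133 * (‖v‖⁻¹) ^ 6) * ‖e‖ ^ 3 * (‖v + k • e‖⁻¹) ^ 9 with hM
  have hv2 : 0 < ‖v‖ ^ 2 := by positivity
  have hqpos : ∀ t : ℝ, 0 ≤ t → 0 < ‖v + t • e‖ ^ 2 := fun t ht =>
    lt_of_lt_of_le hv2 (le_trans (by nlinarith) (h1_line_norm_sq_ge hve ht).1)
  have hdΦ : ∀ t : ℝ, 0 ≤ t → HasDerivAt Φ (F t) t := fun t ht => h1_line_hasDerivAt_prim (hqpos t ht).ne'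
  have hdF : ∀ t : ℝ, 0 ≤ t → HasDerivAt F (F₁ t) t := fun t ht => h1_line_hasDerivAt_load (hqpos t ht).ne'
  have hdF₁ : ∀ t : ℝ, 0 ≤ t → HasDerivAt F₁ (F₂ t) t := fun t ht => h1_line_hasDerivAt_load2 (hqpos t ht).ne'
  have hkk : k ≤ k + 1 := by linarith
  have hI : Set.uIcc k (k + 1) = Set.Icc k (k + 1) := Set.uIcc_of_le hkk
  have hmem : ∀ t ∈ Set.uIcc k (k + 1), 0 ≤ t := fun t ht => by rw [hI] at ht; exact hk.trans ht.1
  -- continuity ⇒ integrability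
  have hFc : ContinuousOn F (Set.uIcc k (k + 1)) := fun t ht =>
    (hdF t (hmem t ht)).continuousAt.continuousWithinAt
  have hF₁c : ContinuousOn F₁ (Set.uIcc k (k + 1)) := fun t ht =>
    (hdF₁ t (hmem t ht)).continuousAt.continuousWithinAt
  have hFi : IntervalIntegrable F MeasureTheory.volume k (k + 1) := hFc.intervalIntegrable
  have hF₁i : IntervalIntegrable F₁ MeasureTheory.volume k (k + 1) := hF₁c.intervalIntegrable
  -- FTC for `Φ`
  have hFTC : ∫ s in k..(k + 1), F s = Φ (k + 1) - Φ k :=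
    intervalIntegral.integral_eq_sub_of_hasDerivAt (fun t ht => hdΦ t (hmem t ht)) hFi
  -- integration by parts against `u(s) = s − (k + ½)`
  set u : ℝ → ℝ := fun s => s - (k + 1 / 2) with hu
  have huc : Continuous u := continuous_id.sub continuous_const
  have hdu : ∀ s : ℝ, HasDerivAt u ((fun _ : ℝ => (1 : ℝ)) s) s := fun s => by
    show HasDerivAt (fun s : ℝ => s - (k + 1 / 2)) 1 s
    exact (hasDerivAt_id' s).sub_const (k + 1 / 2)
  have h1i : IntervalIntegrable (fun _ : ℝ => (1 : ℝ)) MeasureTheory.volume k (k + 1) := intervalIntegrable_const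
  have hparts : ∫ s in k..(k + 1), u s * F₁ s =
      u (k + 1) * F (k + 1) - u k * F k - ∫ s in k..(k + 1), (fun _ : ℝ => (1 : ℝ)) s * F s :=
    intervalIntegral.integral_mul_deriv_eq_deriv_mul (fun s _ => hdu s) (fun t ht => hdF t (hmem t ht)) h1i hF₁i
  have hIval : ∫ s in k..(k + 1), u s * F₁ s = 1 / 2 * F (k + 1) + 1 / 2 * F k - (Φ (k + 1) - Φ k) := by
    rw [hparts]
    simp only [one_mul]
    rw [hFTC, hu]
    ring
  -- the centred form of the integral
  set c : ℝ := F₁ (k + 1 / 2) with hc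
  have hGi : IntervalIntegrable (fun s => u s * (F₁ s - c)) MeasureTheory.volume k (k + 1) :=
    (huc.continuousOn.mul (hF₁c.sub continuousOn_const)).intervalIntegrable
  have hUi : IntervalIntegrable (fun s => u s * c) MeasureTheory.volume k (k + 1) :=
    (huc.continuousOn.mul continuousOn_const).intervalIntegrable
  have hcent : ∫ s in k..(k + 1), u s * F₁ s = ∫ s in k..(k + 1), u s * (F₁ s - c) := by
    have h1 : (∫ s in k..(k + 1), u s * (F₁ s - c)) + ∫ s in k..(k + 1), u s * c =
        ∫ s in k..(k + 1), u s * F₁ s := by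
      rw [← intervalIntegral.integral_add hGi hUi]
      congr 1; funext s; ring
    have h2 : ∫ s in k..(k + 1), u s * c = 0 := by
      rw [intervalIntegral.integral_mul_const, hu]
      show (∫ s in k..(k + 1), (s - (k + 1 / 2))) * c = 0
      rw [h1_integral_centered k, zero_mul]
    linarith
  -- the bound on `F″` on `[k, k+1]` and the mean value estimate
  have hkpos : 0 < ‖v + k • e‖ := by
    have h := hqpos k hk
    have hne : ‖v + k • e‖ ≠ 0 := fun h0 => by rw [h0] at h; simp at h
    exact lt_of_le_of_ne (norm_nonneg _) (Ne.symm hne)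
  have hM0 : 0 ≤ M := by positivity
  have hF₂le : ∀ t ∈ Set.Icc k (k + 1), ‖F₂ t‖ ≤ M := by
    intro t ht
    have ht0 : 0 ≤ t := hk.trans ht.1
    rw [Real.norm_eq_abs]
    refine (h1_line_load2_le hv hve ht0).trans ?_
    have hle : ‖v + k • e‖ ≤ ‖v + t • e‖ := by
      have h2 := h1_line_norm_sq_mono hve hk ht.1
      exact (pow_le_pow_iff_left₀ (norm_nonneg _) (norm_nonneg _) two_ne_zero).mp h2
    have hmono : (‖v + t • e‖⁻¹) ^ 9 ≤ (‖v + k • e‖⁻¹) ^ 9 :=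
      pow_le_pow_left₀ (by positivity) (inv_anti₀ hkpos hle) 9
    exact mul_le_mul_of_nonneg_left hmono (by positivity)
  have hLip : ∀ s ∈ Set.Icc k (k + 1), ‖F₁ s - F₁ (k + 1 / 2)‖ ≤ M * ‖s - (k + 1 / 2)‖ := by
    intro s hs
    have hmid : k + 1 / 2 ∈ Set.Icc k (k + 1) := ⟨by linarith, by linarith⟩
    exact Convex.norm_image_sub_le_of_norm_hasDerivWithin_le
      (fun t ht => (hdF₁ t (hk.trans ht.1)).hasDerivWithinAt) hF₂le (convex_Icc k (k + 1)) hmid hs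
  have hpt : ∀ᵐ s ∂MeasureTheory.volume, s ∈ Set.Ioc k (k + 1) →
      ‖u s * (F₁ s - c)‖ ≤ M * (s - (k + 1 / 2)) ^ 2 := by
    refine Filter.Eventually.of_forall fun s hs => ?_
    have hs' : s ∈ Set.Icc k (k + 1) := ⟨hs.1.le, hs.2⟩
    have h1 := hLip s hs'
    simp only [Real.norm_eq_abs] at h1 ⊢
    rw [abs_mul]
    show |s - (k + 1 / 2)| * |F₁ s - c| ≤ M * (s - (k + 1 / 2)) ^ 2
    calc |s - (k + 1 / 2)| * |F₁ s - c| ≤ |s - (k + 1 / 2)| * (M * |s - (k + 1 / 2)|) :=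
          mul_le_mul_of_nonneg_left h1 (abs_nonneg _)
      _ = M * |s - (k + 1 / 2)| ^ 2 := by ring
      _ = M * (s - (k + 1 / 2)) ^ 2 := by rw [sq_abs]
  have hgi : IntervalIntegrable (fun s : ℝ => M * (s - (k + 1 / 2)) ^ 2) MeasureTheory.volume k (k + 1) :=
    (continuous_const.mul ((continuous_id.sub continuous_const).pow 2)).intervalIntegrable _ _
  have hInorm : ‖∫ s in k..(k + 1), u s * (F₁ s - c)‖ ≤ ∫ s in k..(k + 1), M * (s - (k + 1 / 2)) ^ 2 :=
    intervalIntegral.norm_integral_le_of_norm_le hkk hpt hgi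
  have hIeval : ∫ s in k..(k + 1), M * (s - (k + 1 / 2)) ^ 2 = M * (1 / 12) := by
    rw [intervalIntegral.integral_const_mul, h1_integral_sq_centered]
  -- assemble
  have key : F (k + 1) - (Φ (k + 1) - Φ k) - 1 / 2 * (F (k + 1) - F k) = ∫ s in k..(k + 1), u s * (F₁ s - c) := by
    rw [← hcent, hIval]; ring
  show |F (k + 1) - (Φ (k + 1) - Φ k) - 1 / 2 * (F (k + 1) - F k)| ≤ 1 / 12 * M
  rw [key]
  have h := hInorm
  rw [Real.norm_eq_abs, hIeval] at h
  linarith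

/-- **Second-order Euler–Maclaurin expansion of the outgoing line-truss tail.**  For `v ≠ 0`, `e ≠ 0`, `⟪v,e⟫ ≥ 0`:
`|Σ_{m ≥ 1} W′(‖v + me‖²)⟪v + me, e⟫ + ½V_LJ(‖v‖) + ½W′(‖v‖²)⟪v,e⟫| ≤ (K₂/12)·(‖e‖³‖v‖⁻⁹ + (5π/32)‖e‖²‖v‖⁻⁸)`,
`K₂ = 52 + 133‖v‖⁻⁶`: the tension is `−½V_LJ(r) − ½W′(r²)⟪v,e⟫ + O(‖e‖²r⁻⁸)` with the FIRST-ORDER anisotropy explicit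
(sum of the trapezoid steps `h1_tail_step2`, telescoping of `Φ` and of `½(F(k+1) − F(k))`, lattice sum `h1_quartic_sum_le`).
[folklore] -/
theorem h1_tail_asymp2 (hv : 0 < ‖v‖) (he : 0 < ‖e‖) (hve : 0 ≤ inner ℝ v e) :
    |∑' m : ℕ, ljSqDeriv (‖v + ((m : ℝ) + 1) • e‖ ^ 2) * inner ℝ (v + ((m : ℝ) + 1) • e) e +
        1 / 2 * lennardJones ‖v‖ + 1 / 2 * (ljSqDeriv (‖v‖ ^ 2) * inner ℝ v e)| ≤
      (52 + 133 * (‖v‖⁻¹) ^ 6) / 12 * (‖e‖ ^ 3 * (‖v‖⁻¹) ^ 9 + 5 * Real.pi / 32 * (‖e‖ ^ 2 * (‖v‖⁻¹) ^ 8)) := by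
  obtain ⟨hgsum, hgle⟩ := h1_quartic_sum_le hv he
  set K₂ : ℝ := 52 + 133 * (‖v‖⁻¹) ^ 6 with hK₂
  have hK0 : 0 ≤ K₂ := by positivity
  set ρ₀ := min ‖v‖ ‖e‖ with hρ₀
  have hρ : 0 < ρ₀ := lt_min hv he
  have hρv : ρ₀ ≤ ‖v‖ := min_le_left _ _
  have hρe : ρ₀ ≤ ‖e‖ := min_le_right _ _
  set Φ : ℝ → ℝ := fun t => 1 / 2 * (1 / 12 * ((‖v + t • e‖ ^ 2)⁻¹) ^ 6 - 1 / 6 * ((‖v + t • e‖ ^ 2)⁻¹) ^ 3)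
    with hΦ
  set F : ℝ → ℝ := fun t => ljSqDeriv (‖v + t • e‖ ^ 2) * inner ℝ (v + t • e) e with hF
  set g : ℕ → ℝ := fun m => ((‖v‖ ^ 2 + (m : ℝ) ^ 2 * ‖e‖ ^ 2)⁻¹) ^ 4 with hg
  set C : ℝ := K₂ / 12 * ‖e‖ ^ 3 * ‖v‖⁻¹ with hC
  have hC0 : 0 ≤ C := by positivity
  -- summability of the loads, and their limits
  have hFsum : Summable fun m : ℕ => F ((m : ℝ) + 1) := (h1_master hρ hρv hρe hve).1
  set f : ℕ → ℝ := fun m => F m with hf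
  have hf1 : Summable fun m : ℕ => f (m + 1) := hFsum.congr fun m => by simp [hf]
  have hFsum0 : Summable f := (summable_nat_add_iff 1).mp hf1
  -- the trapezoid steps, dominated by `C · g m`
  have hI : ∀ m : ℕ, |F ((m : ℝ) + 1) - (Φ ((m : ℝ) + 1) - Φ m) - 1 / 2 * (F ((m : ℝ) + 1) - F m)| ≤ C * g m := by
    intro m
    have hm : (0 : ℝ) ≤ m := Nat.cast_nonneg m
    refine (h1_tail_step2 hv hve hm).trans ?_
    have hsq := (h1_line_norm_sq_ge hve hm).1
    have hq0 : 0 < ‖v‖ ^ 2 + (m : ℝ) ^ 2 * ‖e‖ ^ 2 := by positivity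
    have hn2 : ‖v‖ ^ 2 ≤ ‖v + (m : ℝ) • e‖ ^ 2 := le_trans (by nlinarith) hsq
    have hn : ‖v‖ ≤ ‖v + (m : ℝ) • e‖ :=
      (pow_le_pow_iff_left₀ (norm_nonneg _) (norm_nonneg _) two_ne_zero).mp hn2
    have hnpos : 0 < ‖v + (m : ℝ) • e‖ := hv.trans_le hn
    have e1 : (‖v + (m : ℝ) • e‖⁻¹) ^ 9 = ‖v + (m : ℝ) • e‖⁻¹ * ((‖v + (m : ℝ) • e‖ ^ 2)⁻¹) ^ 4 := by
      rw [← inv_pow, ← pow_mul]; ring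
    have h1 : ‖v + (m : ℝ) • e‖⁻¹ ≤ ‖v‖⁻¹ := inv_anti₀ hv hn
    have h2 : ((‖v + (m : ℝ) • e‖ ^ 2)⁻¹) ^ 4 ≤ g m := pow_le_pow_left₀ (by positivity) (inv_anti₀ hq0 hsq) 4
    have h3 : (‖v + (m : ℝ) • e‖⁻¹) ^ 9 ≤ ‖v‖⁻¹ * g m := by
      rw [e1]; exact mul_le_mul h1 h2 (by positivity) (by positivity)
    calc 1 / 12 * (K₂ * ‖e‖ ^ 3 * (‖v + (m : ℝ) • e‖⁻¹) ^ 9)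
        ≤ 1 / 12 * (K₂ * ‖e‖ ^ 3 * (‖v‖⁻¹ * g m)) := by gcongr
      _ = C * g m := by rw [hC]; ring
  -- the difference sequences and their sums
  have hDsum : Summable fun m : ℕ => 1 / 2 * (F ((m : ℝ) + 1) - F m) := (hFsum.sub hFsum0).mul_left (1 / 2)
  have hDtsum : ∑' m : ℕ, 1 / 2 * (F ((m : ℝ) + 1) - F m) = -(1 / 2) * F 0 := by
    rw [tsum_mul_left, hFsum.tsum_sub hFsum0, hFsum0.tsum_eq_zero_add]
    have e2 : ∑' m : ℕ, f (m + 1) = ∑' m : ℕ, F ((m : ℝ) + 1) := tsum_congr fun m => by simp [hf]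
    rw [e2]
    simp only [hf, Nat.cast_zero]
    ring
  have hIsum : Summable fun m : ℕ =>
      F ((m : ℝ) + 1) - (Φ ((m : ℝ) + 1) - Φ m) - 1 / 2 * (F ((m : ℝ) + 1) - F m) :=
    Summable.of_norm_bounded (g := fun m : ℕ => C * g m) (hgsum.mul_left C) fun m => by
      rw [Real.norm_eq_abs]; exact hI m
  have htele : Summable fun m : ℕ => Φ ((m : ℝ) + 1) - Φ m := by
    have := (hFsum.sub hDsum).sub hIsum
    exact this.congr fun m => by ring
  have htele_sum : ∑' m : ℕ, (Φ ((m : ℝ) + 1) - Φ m) = -Φ 0 := by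
    have h1 : Tendsto (fun n : ℕ => ∑ i ∈ Finset.range n, (Φ ((i : ℝ) + 1) - Φ i)) atTop
        (𝓝 (∑' m : ℕ, (Φ ((m : ℝ) + 1) - Φ m))) := htele.hasSum.tendsto_sum_nat
    have h2 : (fun n : ℕ => ∑ i ∈ Finset.range n, (Φ ((i : ℝ) + 1) - Φ i)) = fun n : ℕ => Φ n - Φ 0 := by
      funext n
      have := Finset.sum_range_sub (fun i : ℕ => Φ i) n
      push_cast at this ⊢
      exact this
    rw [h2] at h1
    have h3 : Tendsto (fun n : ℕ => Φ n - Φ 0) atTop (𝓝 (0 - Φ 0)) :=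
      (h1_line_prim_tendsto_zero hρ hρv hρe hve).sub tendsto_const_nhds
    have := tendsto_nhds_unique h1 h3
    rw [this]; ring
  have hΦ0 : Φ 0 = 1 / 2 * lennardJones ‖v‖ := by
    rw [hΦ, lennardJones]
    simp only [zero_smul, add_zero, inv_pow]
    ring
  have hF0 : F 0 = ljSqDeriv (‖v‖ ^ 2) * inner ℝ v e := by
    simp [hF]
  -- the main identity
  have hmain : ∑' m : ℕ, F ((m : ℝ) + 1) + Φ 0 + 1 / 2 * F 0 =
      ∑' m : ℕ, (F ((m : ℝ) + 1) - (Φ ((m : ℝ) + 1) - Φ m) - 1 / 2 * (F ((m : ℝ) + 1) - F m)) := by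
    rw [(hFsum.sub htele).tsum_sub hDsum, hFsum.tsum_sub htele, htele_sum, hDtsum]
    ring
  have hfinal : C * ((‖v‖⁻¹) ^ 8 + 5 * Real.pi / 32 * ((‖v‖⁻¹) ^ 7 / ‖e‖)) =
      K₂ / 12 * (‖e‖ ^ 3 * (‖v‖⁻¹) ^ 9 + 5 * Real.pi / 32 * (‖e‖ ^ 2 * (‖v‖⁻¹) ^ 8)) := by
    rw [hC]
    field_simp
  -- assemble
  show |∑' m : ℕ, F ((m : ℝ) + 1) + 1 / 2 * lennardJones ‖v‖ + 1 / 2 * (ljSqDeriv (‖v‖ ^ 2) * inner ℝ v e)| ≤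
    K₂ / 12 * (‖e‖ ^ 3 * (‖v‖⁻¹) ^ 9 + 5 * Real.pi / 32 * (‖e‖ ^ 2 * (‖v‖⁻¹) ^ 8))
  rw [← hΦ0, ← hF0, hmain, ← hfinal]
  calc |∑' m : ℕ, (F ((m : ℝ) + 1) - (Φ ((m : ℝ) + 1) - Φ m) - 1 / 2 * (F ((m : ℝ) + 1) - F m))|
      ≤ ∑' m : ℕ, |F ((m : ℝ) + 1) - (Φ ((m : ℝ) + 1) - Φ m) - 1 / 2 * (F ((m : ℝ) + 1) - F m)| :=
        h1_abs_tsum_le hIsum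
    _ ≤ ∑' m : ℕ, C * g m := Summable.tsum_le_tsum hI hIsum.abs (hgsum.mul_left C)
    _ = C * ∑' m : ℕ, g m := tsum_mul_left
    _ ≤ C * ((‖v‖⁻¹) ^ 8 + 5 * Real.pi / 32 * ((‖v‖⁻¹) ^ 7 / ‖e‖)) := mul_le_mul_of_nonneg_left hgle hC0

end Line2

end Summit.AtomisticToContinuum.Crystallization.Theorems.StrictSplittingRuleBirth

end
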